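import Mathlib.LinearAlgebra.Matrix.SpecialLinearGroup
import Mathlib.RingTheory.Nullstellensatz
import Mathlib.RingTheory.MvPolynomial.Tower
import Literature.Computability.AlgebraicComplexity.Polystability
import Literature.Computability.AlgebraicComplexity.OrbitClosureProofs
import Literature.Computability.AlgebraicComplexity.MultiplicityObstructionsProofs
import HarnessLib

/-!
# Base change of Zariski closures, orbits and orbit closures along a field extension
# (the algebraic Lefschetz principle, part I)

Elementary transfer lemmas along an extension of fields `k → K` (`[Algebra k K]`), used by the
cell `val-lit` to move GIT statements typed over "every algebraically closed field of
characteristic `0`" (Mulmuley–Sohoni 2001, Thm. 5.1 = the tree's fact `MS2001_thm_5_1`) between an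
abstract algebraically closed field, a countable algebraically closed subfield, and `ℂ`
(where `MS2001_thm_5_1_complex` is proved). Everything here is classical ("Lefschetz
principle" in its algebraic form: statements about finitely many polynomials descend to a
finitely generated subfield and are insensitive to extension of algebraically closed scalars —
Weil, *Foundations* 1946; Eklof 1973 §0; for orbit closures cf. Mumford–Fogarty–Kirwan, GIT
Ch. 0 §2 and Ch. 1 §1 on base change). THEOREMS ONLY apart from one bookkeeping definition
(`genericCoeff`, the coefficients of the generic linear substitute of a polynomial); no named
facts (D-0026).

## Contents

* § 1 `basisComponent`: a polynomial over `K` decomposes uniquely as `∑_j b_j · P_j` with `P_j`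
  over `k` along a `k`-basis `b` of `K`; evaluation at `k`-rational points.
* § 2 **Ascent of Zariski closure**: `x ∈ \overline{S}` over `k` implies `x ∈ \overline{S}` over
  `K` (`comp_mem_zariskiClosure_image`), for any subset `S ⊆ k^ι` of any affine space.
* § 3 `genericCoeff` and its base change: `coeff_d (A · f)` is a polynomial in `A` with
  coefficients in `k`, compatibly with `k → K` (`map_genericCoeff`, `aeval_genericCoeff`).
* § 4 images of `GL`/`SL`-orbits under base change; **ascent of orbit-closure membership**
  `g ∈ Δ[f] ⇒ g_K ∈ Δ[f_K]` (`map_mem_orbitClosure_map`) and of membership in the Zariski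
  closure of an `SL`-orbit.
* § 5 **Descent of orbit-closure membership** for an infinite base field:
  `g_K ∈ Δ[f_K] ⇒ g ∈ Δ[f]` (`mem_orbitClosure_of_map_mem`) — a polynomial identity holding on
  `GL_n(k)` holds on `GL_n(K)` (`MvPolynomial.eq_of_eval_eq_on_gl`).
* § 6 **Hilbert's Nullstellensatz as a transfer tool** (Mathlib's relative form
  `MvPolynomial.vanishingIdeal_zeroLocus_eq_radical`): over an algebraically closed `k`, a
  polynomial identity holding on the `k`-points of an affine `k`-variety holds on its `K`-points
  for every extension `K` (`aeval_eq_zero_of_forall_zeroLocus`); and a system of polynomial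
  equations over `k` with a solution in some extension `K` has a solution in `k`
  (`exists_mem_zeroLocus_of_mem_zeroLocus`).

Honest framing: bookkeeping for the cell's literature ledger (row MS2001-A); nothing here bears
on VP versus VNP.

## References

* A. Weil, *Foundations of Algebraic Geometry* (1946), Ch. I–II (specialisations, fields of
  definition); P. C. Eklof, *Lefschetz's principle and local functors*, Proc. AMS 37 (1973) §0.
* J. S. Milne, *Algebraic Groups*, CUP (2017), §1.b–1.e: Prop. 1.11 ("a schematically dense
  subset remains schematically dense under extension of the base field", held text
  `book:milnend-algebraic-groups` p0096:L34), Cor. 1.17 / A.48 (`X(k)` dense for `k` separably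
  closed, p0097:L25, p0625:L5), Aside 3.17 / Thm. 17.93 (`G(k)` dense for `k` infinite, p0148:L25,
  p0429:L9). [Milne2017AlgebraicGroups]
* M. F. Atiyah, I. G. Macdonald, *Introduction to Commutative Algebra* (1969), Cor. 7.10 and
  Ex. 7.14 (Nullstellensatz; Mathlib `MvPolynomial.vanishingIdeal_zeroLocus_eq_radical`).
  [AtiyahMacdonald1969]
* D. Mumford, J. Fogarty, F. Kirwan, *Geometric Invariant Theory*, 3rd ed., Ch. 0 §2, Ch. 1 §1.
* K. Mulmuley, M. Sohoni, *Geometric complexity theory I*, SIAM J. Comput. 31 (2001), Thm. 5.1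
  (the consumer: `MS2001_thm_5_1`). [MulmuleySohoniSIAM2001]

## Provenance

Cell `val-lit`, seat `val-lit-x3` generation 5 (cross-ladder literature seat; MS2001-A residue).
-/

noncomputable section

open MvPolynomial

namespace Literature.Computability.AlgebraicComplexity

/-! ### § 1 Decomposition of polynomials over `K` along a `k`-basis of `K` -/

section BasisDecomposition

variable {k K : Type*} [Field k] [Field K] [Algebra k K] {τ : Type*} {ι' : Type*} [DecidableEq ι']

/-- The `j`-th component of a polynomial `P` over `K` along a `k`-basis `b` of `K`: the polynomial
over `k` whose `m`-th coefficient is the `j`-th coordinate of the `m`-th coefficient of `P`.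
[folklore] -/
def basisComponent (b : Module.Basis ι' k K) (j : ι') (P : MvPolynomial τ K) : MvPolynomial τ k :=
  ∑ m ∈ P.support, monomial m (b.repr (coeff m P) j)

omit [DecidableEq ι'] in
/-- Coefficients of the basis components. [cite: Milne2017AlgebraicGroups, Prop. 1.11 (proof; `k'` flat over `k`)] -/
@[simp]
theorem coeff_basisComponent (b : Module.Basis ι' k K) (j : ι') (P : MvPolynomial τ K)
    (m : τ →₀ ℕ) : coeff m (basisComponent b j P) = b.repr (coeff m P) j := by
  classical
  simp only [basisComponent, coeff_sum, coeff_monomial]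
  rw [Finset.sum_ite_eq']
  split_ifs with hm
  · rfl
  · rw [notMem_support_iff.mp hm, map_zero, Finsupp.zero_apply]

/-- The (finite) set of basis indices along which some coefficient of `P` has a non-zero
coordinate. [folklore] -/
def basisIndexSet (b : Module.Basis ι' k K) (P : MvPolynomial τ K) : Finset ι' :=
  P.support.biUnion fun m => (b.repr (coeff m P)).support

/-- Outside `basisIndexSet b P` all basis components of `P` vanish. [cite: Milne2017AlgebraicGroups, Prop. 1.11 (proof; `k'` flat over `k`)] -/
theorem basisComponent_eq_zero_of_notMem {b : Module.Basis ι' k K} {P : MvPolynomial τ K}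
    {j : ι'} (hj : j ∉ basisIndexSet b P) : basisComponent b j P = 0 := by
  classical
  ext m
  rw [coeff_basisComponent, coeff_zero]
  by_contra h
  apply hj
  rw [basisIndexSet, Finset.mem_biUnion]
  refine ⟨m, ?_, Finsupp.mem_support_iff.mpr h⟩
  rw [mem_support_iff]
  intro h0
  rw [h0, map_zero, Finsupp.zero_apply] at h
  exact h rfl

/-- **Decomposition along a basis**: `P = ∑_{j ∈ J} b_j · (P_j)_K` with `J = basisIndexSet b P` and
`P_j = basisComponent b j P` (the polynomial ring over `K` is free over the one over `k` on a
`k`-basis of `K` — the flatness used in Milne's proof of Prop. 1.11). [cite: Milne2017AlgebraicGroups, Prop. 1.11 (proof; `k'` flat over `k`)] -/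
theorem eq_sum_basisComponent (b : Module.Basis ι' k K) (P : MvPolynomial τ K) :
    P = ∑ j ∈ basisIndexSet b P, C (b j) * map (algebraMap k K) (basisComponent b j P) := by
  classical
  ext m
  simp only [coeff_sum, coeff_C_mul, coeff_map, coeff_basisComponent]
  have hrepr : coeff m P = ∑ j ∈ basisIndexSet b P, b.repr (coeff m P) j • b j := by
    by_cases hm : m ∈ P.support
    · have hsub : (b.repr (coeff m P)).support ⊆ basisIndexSet b P :=
        Finset.subset_biUnion_of_mem (fun m => (b.repr (coeff m P)).support) hm
      rw [← Finset.sum_subset hsub (fun j _ hj => by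
        rw [Finsupp.notMem_support_iff.mp hj, zero_smul])]
      conv_lhs => rw [← b.linearCombination_repr (coeff m P)]
      rw [Finsupp.linearCombination_apply, Finsupp.sum]
    · rw [notMem_support_iff.mp hm]
      simp
  conv_lhs => rw [hrepr]
  refine Finset.sum_congr rfl fun j _ => ?_
  rw [Algebra.smul_def, mul_comm]

omit [DecidableEq ι'] in
/-- **Uniqueness of the decomposition**: if `∑_{j ∈ J} b_j · (Q_j)_K = 0` then every `Q_j`, `j ∈ J`,
vanishes. [cite: Milne2017AlgebraicGroups, Prop. 1.11 (proof; `k'` flat over `k`)] -/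
theorem eq_zero_of_sum_basis_mul_map_eq_zero (b : Module.Basis ι' k K) (J : Finset ι')
    (Q : ι' → MvPolynomial τ k)
    (h : ∑ j ∈ J, C (b j) * map (algebraMap k K) (Q j) = 0) : ∀ j ∈ J, Q j = 0 := by
  intro j hj
  ext m
  have hm := congr_arg (coeff m) h
  simp only [coeff_sum, coeff_C_mul, coeff_map, coeff_zero] at hm
  have hm' : ∑ i ∈ J, coeff m (Q i) • b i = 0 := by
    rw [← hm]
    refine Finset.sum_congr rfl fun i _ => ?_
    rw [Algebra.smul_def, mul_comm]
  rw [coeff_zero]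
  exact linearIndependent_iff'.mp b.linearIndependent J (fun i => coeff m (Q i)) hm' j hj

omit [DecidableEq ι'] in
/-- Evaluating a polynomial over `k` at a `k`-rational point of `K^τ` (evaluation commutes with
extension of scalars). [cite: Milne2017AlgebraicGroups, §1.e (extension of scalars)] -/
theorem eval_algebraMap_comp_map (y : τ → k) (q : MvPolynomial τ k) :
    eval (fun t => algebraMap k K (y t)) (map (algebraMap k K) q) = algebraMap k K (eval y q) := by
  rw [eval_map, ← eval₂_id, eval₂_comp_left (algebraMap k K) (RingHom.id k) y q, RingHom.comp_id]
  rfl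

omit [DecidableEq ι'] in
/-- Over the base field itself, `aeval` at a point is `eval` (by `rfl`). [folklore] -/
private theorem aeval_self_apply (y : τ → k) (q : MvPolynomial τ k) : aeval y q = eval y q := rfl

omit [DecidableEq ι'] in
/-- Evaluating a polynomial over `k` at a `k`-rational point of `K^τ`, `aeval` form (evaluation
commutes with extension of scalars). [cite: Milne2017AlgebraicGroups, §1.e (extension of scalars)] -/
theorem aeval_algebraMap_comp (y : τ → k) (q : MvPolynomial τ k) :
    aeval (fun t => algebraMap k K (y t)) q = algebraMap k K (aeval y q) := by
  rw [aeval_def, eval₂_eq_eval_map, eval_algebraMap_comp_map, aeval_self_apply]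

omit [DecidableEq ι'] in
/-- Evaluating a decomposed polynomial at a `k`-rational point: `(∑ b_j (Q_j)_K)(y) = ∑ b_j Q_j(y)`.
[cite: Milne2017AlgebraicGroups, Prop. 1.11 (proof; `k'` flat over `k`)] -/
theorem eval_sum_basis_mul_map (b : Module.Basis ι' k K) (J : Finset ι') (Q : ι' → MvPolynomial τ k)
    (y : τ → k) :
    eval (fun t => algebraMap k K (y t)) (∑ j ∈ J, C (b j) * map (algebraMap k K) (Q j)) =
      ∑ j ∈ J, eval y (Q j) • b j := by
  simp only [map_sum, map_mul, eval_C, eval_algebraMap_comp_map]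
  refine Finset.sum_congr rfl fun j _ => ?_
  rw [Algebra.smul_def, mul_comm]

/-- If a polynomial over `K` vanishes at a `k`-rational point, so does each of its basis components
(the injectivity step of Milne's proof of Prop. 1.11). [cite: Milne2017AlgebraicGroups, Prop. 1.11 (proof; `k'` flat over `k`)] -/
theorem eval_basisComponent_eq_zero (b : Module.Basis ι' k K) {P : MvPolynomial τ K} {y : τ → k}
    (h : eval (fun t => algebraMap k K (y t)) P = 0) (j : ι') :
    eval y (basisComponent b j P) = 0 := by
  classical
  by_cases hj : j ∈ basisIndexSet b P
  · rw [eq_sum_basisComponent b P, eval_sum_basis_mul_map] at h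
    exact linearIndependent_iff'.mp b.linearIndependent (basisIndexSet b P)
      (fun i => eval y (basisComponent b i P)) h j hj
  · rw [basisComponent_eq_zero_of_notMem hj, map_zero]

end BasisDecomposition

/-! ### § 2 Ascent of Zariski closure along a field extension -/

section ZariskiAscent

variable {k K : Type*} [Field k] [Field K] [Algebra k K] {ι : Type*}

/-- **Zariski closure ascends**: if `x` lies in the Zariski closure of `S ⊆ k^ι` (common zeros over
`k` of the polynomials over `k` vanishing on `S`), then `x` lies in the Zariski closure over `K` of
the image of `S` in `K^ι`. Proof: decompose a test polynomial over `K` along a `k`-basis of `K`;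
each component vanishes on `S`, hence at `x`. (Weil 1946, Ch. II; the elementary half of the
Lefschetz principle; Milne, Prop. 1.11: "A schematically dense subset remains schematically dense
under extension of the base field".) [cite: Milne2017AlgebraicGroups, Prop. 1.11] -/
theorem comp_mem_zariskiClosure_image {S : Set (ι → k)} {x : ι → k} (hx : x ∈ zariskiClosure S) :
    (fun i => algebraMap k K (x i)) ∈
      zariskiClosure ((fun y : ι → k => fun i => algebraMap k K (y i)) '' S) := by
  classical
  rw [mem_zariskiClosure_iff] at hx ⊢
  intro P hP
  let b := Module.Basis.ofVectorSpace k K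
  have hcomp : ∀ j, ∀ y ∈ S, aeval y (basisComponent b j P) = 0 := by
    intro j y hy
    rw [aeval_self_apply]
    exact eval_basisComponent_eq_zero b (hP _ (Set.mem_image_of_mem _ hy)) j
  rw [aeval_self_apply, eq_sum_basisComponent b P, eval_sum_basis_mul_map]
  refine Finset.sum_eq_zero fun j _ => ?_
  have := hx _ (hcomp j)
  rw [aeval_self_apply] at this
  rw [this, zero_smul]

end ZariskiAscent

/-! ### § 3 The generic linear substitute and its base change -/

section GenericCoeff

variable {k K : Type*} [Field k] [Field K] [Algebra k K] {σ : Type*} [Fintype σ] [DecidableEq σ]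

/-- `genericCoeff f d`: the `d`-th coefficient of the generic linear substitute `Y · f` of `f`,
`Y = (Y_{ij})` the generic `σ × σ` matrix — a polynomial in the matrix entries with
coefficients in `k` whose value at `A` is `coeff d (A · f)` (`eval_genericCoeff`).
Mulmuley–Sohoni 2001 §4 (the action map is a morphism). [cite: MulmuleySohoniSIAM2001, §4] -/
def genericCoeff (f : MvPolynomial σ k) (d : σ →₀ ℕ) : MvPolynomial (σ × σ) k :=
  coeff d (linSubst σ (MvPolynomial (σ × σ) k) (Matrix.mvPolynomialX σ σ k)
    (map (C : k →+* MvPolynomial (σ × σ) k) f))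

omit [DecidableEq σ] in
/-- The value of `genericCoeff f d` at a matrix `A` over `k` is `coeff d (A · f)`.
[cite: MulmuleySohoniSIAM2001, §4] -/
theorem eval_genericCoeff (f : MvPolynomial σ k) (d : σ →₀ ℕ) (A : Matrix σ σ k) :
    eval (fun ij : σ × σ => A ij.1 ij.2) (genericCoeff f d) = coeff d (linSubst σ k A f) :=
  eval_coeff_genericLinSubst f d A

omit [DecidableEq σ] in
/-- **The generic coefficients commute with base change**: `(genericCoeff f d)_K =
genericCoeff f_K d` (the action morphism is defined over `k`). [cite: MulmuleySohoniSIAM2001, §4] -/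
theorem map_genericCoeff (f : MvPolynomial σ k) (d : σ →₀ ℕ) :
    map (algebraMap k K) (genericCoeff f d) = genericCoeff (map (algebraMap k K) f) d := by
  unfold genericCoeff
  rw [← coeff_map, map_linSubst (MvPolynomial.map (algebraMap k K))]
  have hX : (Matrix.mvPolynomialX σ σ k).map (MvPolynomial.map (algebraMap k K)) =
      Matrix.mvPolynomialX σ σ K := by
    ext i j : 1
    rw [Matrix.map_apply, Matrix.mvPolynomialX_apply, Matrix.mvPolynomialX_apply, map_X]
  have hf : map (MvPolynomial.map (algebraMap k K)) (map (C : k →+* MvPolynomial (σ × σ) k) f) =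
      map (C : K →+* MvPolynomial (σ × σ) K) (map (algebraMap k K) f) := by
    have hC : (MvPolynomial.map (algebraMap k K)).comp (C : k →+* MvPolynomial (σ × σ) k) =
        (C : K →+* MvPolynomial (σ × σ) K).comp (algebraMap k K) :=
      RingHom.ext fun c => by rw [RingHom.comp_apply, RingHom.comp_apply, map_C]
    rw [map_map, map_map, hC]
  rw [hX, hf]

omit [DecidableEq σ] in
/-- The value of `genericCoeff f d` at a matrix `A` over the EXTENSION field `K` is
`coeff d (A · f_K)`. [cite: MulmuleySohoniSIAM2001, §4] -/
theorem aeval_genericCoeff (f : MvPolynomial σ k) (d : σ →₀ ℕ) (A : Matrix σ σ K) :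
    aeval (fun ij : σ × σ => A ij.1 ij.2) (genericCoeff f d) =
      coeff d (linSubst σ K A (map (algebraMap k K) f)) := by
  rw [aeval_def, eval₂_eq_eval_map, map_genericCoeff, eval_genericCoeff]

omit [DecidableEq σ] in
/-- Pull-back of a test polynomial on coefficient space along `A ↦ coeffVec (A · f_K)`, at a
matrix over the extension field: `(p ∘ genericCoeff f)(A) = p(coeffVec (A · f_K))` (all
evaluations `k`-algebra evaluations into `K`). [cite: MulmuleySohoniSIAM2001, §4] -/
theorem aeval_aeval_genericCoeff (f : MvPolynomial σ k) (p : MvPolynomial (σ →₀ ℕ) k)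
    (A : Matrix σ σ K) :
    aeval (fun ij : σ × σ => A ij.1 ij.2) (aeval (genericCoeff f) p) =
      aeval (coeffVec (linSubst σ K A (map (algebraMap k K) f))) p := by
  have hFG : (fun d => aeval (fun ij : σ × σ => A ij.1 ij.2) (genericCoeff f d)) =
      coeffVec (linSubst σ K A (map (algebraMap k K) f)) := by
    funext d
    exact aeval_genericCoeff f d A
  rw [← AlgHom.comp_apply, comp_aeval, hFG]

/-- Coefficient vectors commute with base change (a form as a point of `V = Sym^m`, extension of
scalars on coordinates). [cite: MulmuleySohoniSIAM2001, §4] -/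
theorem coeffVec_map {σ' : Type*} (g : MvPolynomial σ' k) :
    coeffVec (map (algebraMap k K) g) = fun d => algebraMap k K (coeffVec g d) := by
  funext d
  rw [coeffVec_apply, coeffVec_apply, coeff_map]

end GenericCoeff

/-! ### § 4 Orbits and orbit closures under base change: ascent -/

section OrbitAscent

variable {k K : Type*} [Field k] [Field K] [Algebra k K] {σ : Type*} [Fintype σ] [DecidableEq σ]

/-- The base change of a `GL_n(k)`-translate is a `GL_n(K)`-translate of the base change (the
orbit map is defined over `k`). [cite: Milne2017AlgebraicGroups, §1.e (extension of scalars)] -/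
theorem map_linSubst_mem_glOrbit (f : MvPolynomial σ k) (A : GL σ k) :
    map (algebraMap k K) (linSubst σ k (A : Matrix σ σ k) f) ∈
      glOrbit σ K (map (algebraMap k K) f) := by
  refine ⟨Matrix.GeneralLinearGroup.map (algebraMap k K) A, ?_⟩
  change linSubstRep σ K (Matrix.GeneralLinearGroup.map (algebraMap k K) A)
    (map (algebraMap k K) f) = _
  rw [linSubstRep_apply, map_linSubst]
  rfl

/-- The base change of an `SL_n(k)`-translate is an `SL_n(K)`-translate of the base change (the
orbit map is defined over `k`). [cite: Milne2017AlgebraicGroups, §1.e (extension of scalars)] -/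
theorem map_linSubst_mem_slOrbit (f : MvPolynomial σ k) (A : Matrix.SpecialLinearGroup σ k) :
    map (algebraMap k K) (linSubst σ k (A : Matrix σ σ k) f) ∈
      slOrbit σ K (map (algebraMap k K) f) := by
  refine ⟨Matrix.SpecialLinearGroup.map (algebraMap k K) A, ?_⟩
  rw [map_linSubst, Matrix.SpecialLinearGroup.map_apply_coe, RingHom.mapMatrix_apply]

/-- Base change maps (the coefficient vectors of) the `GL_n(k)`-orbit into the `GL_n(K)`-orbit.
[cite: Milne2017AlgebraicGroups, §1.e (extension of scalars)] -/
theorem image_coeffVec_glOrbit_subset (f : MvPolynomial σ k) :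
    (fun y : (σ →₀ ℕ) → k => fun d => algebraMap k K (y d)) '' (coeffVec '' glOrbit σ k f) ⊆
      coeffVec '' glOrbit σ K (map (algebraMap k K) f) := by
  rintro _ ⟨_, ⟨_, ⟨A, rfl⟩, rfl⟩, rfl⟩
  refine ⟨_, map_linSubst_mem_glOrbit f A, ?_⟩
  rw [coeffVec_map]
  rfl

/-- Base change maps (the coefficient vectors of) the `SL_n(k)`-orbit into the `SL_n(K)`-orbit.
[cite: Milne2017AlgebraicGroups, §1.e (extension of scalars)] -/
theorem image_coeffVec_slOrbit_subset (f : MvPolynomial σ k) :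
    (fun y : (σ →₀ ℕ) → k => fun d => algebraMap k K (y d)) '' (coeffVec '' slOrbit σ k f) ⊆
      coeffVec '' slOrbit σ K (map (algebraMap k K) f) := by
  rintro _ ⟨_, ⟨_, ⟨A, rfl⟩, rfl⟩, rfl⟩
  refine ⟨_, map_linSubst_mem_slOrbit f A, ?_⟩
  rw [coeffVec_map]

/-- **Orbit-closure membership ascends**: `g ∈ Δ[f]` over `k` implies `g_K ∈ Δ[f_K]` over `K`.
(Milne Prop. 1.11 applied to the orbit: density survives extension of the base field.) [cite: Milne2017AlgebraicGroups, Prop. 1.11] -/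
theorem map_mem_orbitClosure_map {f g : MvPolynomial σ k} (h : g ∈ orbitClosure f) :
    map (algebraMap k K) g ∈ orbitClosure (map (algebraMap k K) f) := by
  change coeffVec (map (algebraMap k K) g) ∈
    zariskiClosure (coeffVec '' glOrbit σ K (map (algebraMap k K) f))
  rw [coeffVec_map]
  exact zariskiClosure_mono (image_coeffVec_glOrbit_subset f) (comp_mem_zariskiClosure_image h)

/-- **Membership in the closure of an `SL`-orbit ascends**: if `coeffVec g` lies in the Zariski
closure of `coeffVec '' (SL_n(k) · f)`, then `coeffVec g_K` lies in the Zariski closure of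
`coeffVec '' (SL_n(K) · f_K)`. [cite: Milne2017AlgebraicGroups, Prop. 1.11] -/
theorem coeffVec_map_mem_zariskiClosure_slOrbit {f g : MvPolynomial σ k}
    (h : coeffVec g ∈ zariskiClosure (coeffVec '' slOrbit σ k f)) :
    coeffVec (map (algebraMap k K) g) ∈
      zariskiClosure (coeffVec '' slOrbit σ K (map (algebraMap k K) f)) := by
  rw [coeffVec_map]
  exact zariskiClosure_mono (image_coeffVec_slOrbit_subset f) (comp_mem_zariskiClosure_image h)

/-- Variant for an arbitrary point of coefficient space: if `v ∈ \overline{coeffVec '' SL·f}` over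
`k` then its image lies in `\overline{coeffVec '' SL·f_K}` over `K`. [cite: Milne2017AlgebraicGroups, Prop. 1.11] -/
theorem comp_mem_zariskiClosure_slOrbit {f : MvPolynomial σ k} {v : (σ →₀ ℕ) → k}
    (h : v ∈ zariskiClosure (coeffVec '' slOrbit σ k f)) :
    (fun d => algebraMap k K (v d)) ∈
      zariskiClosure (coeffVec '' slOrbit σ K (map (algebraMap k K) f)) :=
  zariskiClosure_mono (image_coeffVec_slOrbit_subset f) (comp_mem_zariskiClosure_image h)

end OrbitAscent

/-! ### § 5 Descent of orbit-closure membership (infinite base field) -/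

section OrbitDescent

variable {k K : Type*} [Field k] [Field K] [Algebra k K] {σ : Type*} [Fintype σ] [DecidableEq σ]

/-- A test polynomial on coefficient space that vanishes on `GL_n(k) · f`, `k` infinite, pulls back
to the ZERO polynomial on matrix space (`GL_n(k)` is Zariski dense in `GL_n`, `k` infinite).
[cite: Milne2017AlgebraicGroups, Thm. 17.93 / Aside 3.17 (`G(k)` dense for `k` infinite)] -/
theorem aeval_genericCoeff_eq_zero_of_forall_glOrbit [Infinite k] {f : MvPolynomial σ k}
    {p : MvPolynomial (σ →₀ ℕ) k} (hp : ∀ h ∈ glOrbit σ k f, aeval (coeffVec h) p = 0) :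
    aeval (genericCoeff f) p = 0 := by
  apply MvPolynomial.eq_of_eval_eq_on_gl
  intro g
  rw [map_zero, ← aeval_self_apply]
  have h1 := aeval_aeval_genericCoeff (K := k) f p (g : Matrix σ σ k)
  rw [Algebra.algebraMap_self, map_id] at h1
  rw [h1]
  exact hp _ ⟨g, rfl⟩

/-- If a test polynomial over `k` vanishes on `GL_n(k) · f` (`k` infinite), its base change vanishes
on `GL_n(K) · f_K` (`GL_n(k)` is dense in `GL_n(K)`). [cite: Milne2017AlgebraicGroups, Thm. 17.93 / Aside 3.17 (`G(k)` dense for `k` infinite)] -/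
theorem aeval_map_eq_zero_of_forall_glOrbit [Infinite k] {f : MvPolynomial σ k}
    {p : MvPolynomial (σ →₀ ℕ) k} (hp : ∀ h ∈ glOrbit σ k f, aeval (coeffVec h) p = 0)
    {h : MvPolynomial σ K} (hh : h ∈ glOrbit σ K (map (algebraMap k K) f)) :
    aeval (coeffVec h) (map (algebraMap k K) p) = 0 := by
  obtain ⟨A, rfl⟩ := hh
  change aeval (coeffVec (linSubstRep σ K A (map (algebraMap k K) f))) _ = 0
  rw [aeval_map_algebraMap, linSubstRep_apply, ← aeval_aeval_genericCoeff,
    aeval_genericCoeff_eq_zero_of_forall_glOrbit hp, map_zero]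

/-- **Orbit-closure membership descends** (infinite base field): `g_K ∈ Δ[f_K]` over `K` implies
`g ∈ Δ[f]` over `k`. Proof: a polynomial over `k` vanishing on `GL_n(k)·f` pulls back to a
polynomial on matrix space vanishing on `GL_n(k)`, hence zero (`k` infinite), so its base change
vanishes on `GL_n(K)·f_K`, hence at `g_K`, i.e. at `g`. [cite: Milne2017AlgebraicGroups, Thm. 17.93 / Aside 3.17 (`G(k)` dense for `k` infinite)] -/
theorem mem_orbitClosure_of_map_mem [Infinite k] {f g : MvPolynomial σ k}
    (h : map (algebraMap k K) g ∈ orbitClosure (map (algebraMap k K) f)) :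
    g ∈ orbitClosure f := by
  rw [mem_orbitClosure_iff] at h ⊢
  intro p hp
  have h1 := h (map (algebraMap k K) p) (fun h' hh' => aeval_map_eq_zero_of_forall_glOrbit hp hh')
  rw [aeval_map_algebraMap, coeffVec_map, aeval_algebraMap_comp] at h1
  exact (algebraMap k K).injective (by rw [h1, map_zero])

end OrbitDescent

/-! ### § 6 The Nullstellensatz as a transfer tool -/

section Nullstellensatz

variable {k K : Type*} [Field k] [Field K] [Algebra k K] {τ : Type*} [Finite τ]

/-- **`k`-points are dense in `K`-points** (`k` algebraically closed): a polynomial over `k` that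
vanishes at every `k`-point of the zero set of an ideal `I` over `k` vanishes at every `K`-point of
it, for every extension field `K` — it lies in `√I` by the Nullstellensatz (Milne A.48: "`X(k)` is
dense in `|X|` if `k` is separably closed"). [cite: Milne2017AlgebraicGroups, A.48] -/
theorem aeval_eq_zero_of_forall_zeroLocus [IsAlgClosed k] (I : Ideal (MvPolynomial τ k))
    {h : MvPolynomial τ k} (hh : ∀ x ∈ MvPolynomial.zeroLocus k I, aeval x h = 0)
    {y : τ → K} (hy : y ∈ MvPolynomial.zeroLocus K I) : aeval y h = 0 := by
  have h1 : h ∈ MvPolynomial.vanishingIdeal k (MvPolynomial.zeroLocus k I) :=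
    (MvPolynomial.mem_vanishingIdeal_iff).2 hh
  rw [MvPolynomial.vanishingIdeal_zeroLocus_eq_radical] at h1
  exact (MvPolynomial.mem_vanishingIdeal_iff).1
    (MvPolynomial.radical_le_vanishingIdeal_zeroLocus (K := K) I h1) y hy

/-- **Solutions descend to an algebraically closed base**: a system of polynomial equations over an
algebraically closed field `k` (an ideal `I`) that has a solution in some extension field `K` has
a solution in `k` — otherwise `1 ∈ I` by the (weak) Nullstellensatz. [cite: AtiyahMacdonald1969, Cor. 7.10 / Ex. 7.14 (Nullstellensatz)] -/
theorem exists_mem_zeroLocus_of_mem_zeroLocus [IsAlgClosed k] (I : Ideal (MvPolynomial τ k))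
    {y : τ → K} (hy : y ∈ MvPolynomial.zeroLocus K I) :
    ∃ x : τ → k, x ∈ MvPolynomial.zeroLocus k I := by
  by_contra hne
  push Not at hne
  have hempty : MvPolynomial.zeroLocus k I = ∅ := Set.eq_empty_iff_forall_notMem.mpr hne
  have htop : I.radical = ⊤ := by
    rw [← MvPolynomial.vanishingIdeal_zeroLocus_eq_radical (K := k), hempty,
      MvPolynomial.vanishingIdeal_empty]
  have h1 : (1 : MvPolynomial τ k) ∈ I := by
    rw [Ideal.radical_eq_top.mp htop]
    exact Submodule.mem_top
  have := (MvPolynomial.mem_zeroLocus_iff.1 hy) 1 h1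
  rw [map_one] at this
  exact one_ne_zero this

/-- A proper ideal over `k` has a `K`-point for every ALGEBRAICALLY CLOSED extension `K` (weak
Nullstellensatz, relative form). [cite: AtiyahMacdonald1969, Cor. 7.10 / Ex. 7.14 (Nullstellensatz)] -/
theorem nonempty_zeroLocus_of_ne_top [IsAlgClosed K] {I : Ideal (MvPolynomial τ k)} (hI : I ≠ ⊤) :
    (MvPolynomial.zeroLocus K I).Nonempty := by
  by_contra hne
  rw [Set.not_nonempty_iff_eq_empty] at hne
  apply hI
  have htop : I.radical = ⊤ := by
    rw [← MvPolynomial.vanishingIdeal_zeroLocus_eq_radical (K := K), hne,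
      MvPolynomial.vanishingIdeal_empty]
  exact (Ideal.radical_eq_top.mp htop)

end Nullstellensatz

end Literature.Computability.AlgebraicComplexity

end
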